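import Summits.ResolutionOfSingularities.ResolutionOfSingularities.Theorems.EquisingularLiftEquisingularLiftOrdinaryPointsMatrixForm
import HarnessLib

/-!
# [OURS] ORDINARY MULTIPLE POINTS IN GENERAL POSITION — EACH POINT READ IN A CHART OF THE USER'S CHOICE (two-index transport), matrix form
# (cruxes `EquisingularLift` stmt-…-15660; `EquisingularLiftNat(Three)` stmt-…-20038 / -20148)

[OURS · leafhand-res-equisingularlift-7 g1, 2026-08-31; cell `pub/decomp-res`] AI-produced, weaker than expert review; NOT a statement of any manuscript;
nothing here proves resolution of singularities.  DEF-FREE helper; no `sorry`; standard axioms; ZERO named hypotheses.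

✓ `MultiOrd.elNatAt_of_ordinaryPoints_matrix` (p824955) reads the marked point `B_{·c}` in the chart `x_c ≠ 0` (normalisation `B_{cc} = 1`).  Here the chart is
FREE: for each marked column `c ∈ S` the user picks ANY coordinate `c₀(c)` with `B_{c₀(c) c} = 1` and supplies the translated chart of `F(x_{c₀(c)} := 1)` at the
point.  The transport lemmas of ✓ `…ChartExpansion` / ✓ `…LinearParts` / ✓ `…GeneralPosition` are redone with two indices (`c` = new vertex, `c₀` = chart of
the point):

* `dehomogenize_aeval_eq_sum₂`, `dehomogenize_aeval_eq_initial_add₂` — chart at `e_c` of `σ*P` along the components of the chart of `P` at `e_{c₀}`, for `σ`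
  mapping `e_c` to the line of `e_{c₀}`;
* `aeval_linearPart_linearPart₂` — linear parts of mutually inverse substitutions exchanging the two vertices are mutually inverse;
* ★ `ord_linSubst_of_translatedChart₂` — the tangent-cone transport with a free chart index;
* ★★★ `MultiOrd.elNatAt_of_ordinaryPoints_matrix₂`, ★★★ `StrataSplit.blowupModel_of_ordinaryPoints_matrix₂` — the final statements: `B ∈ GL_{m+3}(K)`, marking
  `S`, chart choice `c₀ : S → coordinates` with `B_{c₀(c),c} = 1`, (ordF) translated charts, (jacF) «every singular point is proportional to a marked column».

References: [Hartshorne1977, I Thm. 5.1, I Ex. 5.8, II Example 7.1.1, II Ex. 7.12]; [Matsumura1987, §14].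
-/

set_option linter.dupNamespace false -- mandated namespace `Summit.<Summit>.<Problem>` of this single-conjunct summit

noncomputable section

open CategoryTheory CategoryTheory.Limits AlgebraicGeometry TopologicalSpace
open MvPolynomial
open Literature.AlgebraicGeometry.Resolution
open Literature.AlgebraicGeometry.Motives Literature.AlgebraicGeometry.Motives.SmoothHypersurface
open Literature.AlgebraicGeometry.Motives.ProjectiveSpace

namespace Summit.ResolutionOfSingularities.ResolutionOfSingularities.Cruxes.EquisingularLiftNat.Sections

namespace MultiOrd

variable {K : Type} [Field K] {N : ℕ}

/-! ## Two-index chart expansion -/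

/-- **Expansion of the chart at `e_c` of `σ*P` along the homogeneous components of the chart of `P` at `e_{c₀}`**:
`(σ*P)(x_c := 1) = Σ_{m ≤ e} ρ_{c₀}^{e−m} · Qₘ(ρ_{c₀.succAbove ·})`, `ρ_i = σ_i(x_c := 1)`, `Q = P(x_{c₀} := 1)`. [cite: Hartshorne1977, I §2, proof of Prop. 2.2] -/
theorem dehomogenize_aeval_eq_sum₂ (c c₀ : Fin (N + 1)) {e : ℕ} {P : MvPolynomial (Fin (N + 1)) K} (hP : P.IsHomogeneous e)
    (σ : Fin (N + 1) → MvPolynomial (Fin (N + 1)) K) :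
    ProjectiveSpace.dehomogenize K c (aeval σ P) = ∑ m ∈ Finset.range (e + 1),
      ProjectiveSpace.dehomogenize K c (σ c₀) ^ (e - m) *
        aeval (fun j => ProjectiveSpace.dehomogenize K c (σ (c₀.succAbove j))) (homogeneousComponent m (ProjectiveSpace.dehomogenize K c₀ P)) := by
  rw [dehomogenize_aeval]
  conv_lhs => rw [eq_sum_X_pow_mul_rename_homogeneousComponent c₀ hP]
  rw [map_sum]
  refine Finset.sum_congr rfl fun m _ => ?_
  rw [map_mul, map_pow, aeval_X, aeval_rename]
  rfl

/-- ★ **Initial form and remainder, two indices**: `P` a form of degree `e` with `P(x_{c₀} := 1) = Φ + Ψ` (`Φ` a form of degree `μ ≤ e`, `Ψ ∈ (y)^{μ+1}`), `σ` a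
substitution whose charts `ρ_i = σ_i(x_c := 1)` have no constant term for `i ≠ c₀` (it maps `e_c` to the line of `e_{c₀}`); `λ = ρ_{c₀}(0)`,
`M_j = ρ_{c₀.succAbove j}`.  Then `(σ*P)(x_c := 1) = λ^{e−μ}·Φ(M) + Ψ'`, `Ψ' ∈ (y)^{μ+1}`. [cite: Matsumura1987, §14] -/
theorem dehomogenize_aeval_eq_initial_add₂ (c c₀ : Fin (N + 1)) {e : ℕ} {P : MvPolynomial (Fin (N + 1)) K} (hP : P.IsHomogeneous e)
    {Φ Ψ : MvPolynomial (Fin N) K} {μ : ℕ} (hΦ : Φ.IsHomogeneous μ)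
    (hΨ : Ψ ∈ Ideal.span (Set.range (X : Fin N → MvPolynomial (Fin N) K)) ^ (μ + 1)) (hμe : μ ≤ e)
    (hdeh : ProjectiveSpace.dehomogenize K c₀ P = Φ + Ψ)
    (σ : Fin (N + 1) → MvPolynomial (Fin (N + 1)) K)
    (hσ : ∀ i, i ≠ c₀ → constantCoeff (ProjectiveSpace.dehomogenize K c (σ i)) = 0) :
    ∃ Ψ' : MvPolynomial (Fin N) K, Ψ' ∈ Ideal.span (Set.range (X : Fin N → MvPolynomial (Fin N) K)) ^ (μ + 1) ∧
      ProjectiveSpace.dehomogenize K c (aeval σ P) =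
        C (constantCoeff (ProjectiveSpace.dehomogenize K c (σ c₀)) ^ (e - μ)) *
          aeval (fun j => ProjectiveSpace.dehomogenize K c (σ (c₀.succAbove j))) Φ + Ψ' := by
  classical
  set I : Ideal (MvPolynomial (Fin N) K) := Ideal.span (Set.range (X : Fin N → MvPolynomial (Fin N) K)) with hI
  set ρc := ProjectiveSpace.dehomogenize K c (σ c₀) with hρc
  set M : Fin N → MvPolynomial (Fin N) K := fun j => ProjectiveSpace.dehomogenize K c (σ (c₀.succAbove j)) with hM
  set lam := constantCoeff ρc with hlam
  have hMmem : ∀ j, M j ∈ I := fun j => mem_span_X_of_constantCoeff_eq_zero (hσ _ (Fin.succAbove_ne c₀ j))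
  obtain ⟨hQμ, hQlt⟩ := homogeneousComponent_add_of_mem_pow hΦ hΨ
  set T : ℕ → MvPolynomial (Fin N) K := fun m => ρc ^ (e - m) *
    aeval M (homogeneousComponent m (ProjectiveSpace.dehomogenize K c₀ P)) with hT
  have hexp : ProjectiveSpace.dehomogenize K c (aeval σ P) = ∑ m ∈ Finset.range (e + 1), T m := dehomogenize_aeval_eq_sum₂ c c₀ hP σ
  have hμmem : μ ∈ Finset.range (e + 1) := Finset.mem_range.mpr (Nat.lt_succ_of_le hμe)
  rw [← Finset.add_sum_erase _ _ hμmem] at hexp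
  have hTμ : T μ = ρc ^ (e - μ) * aeval M Φ := by
    simp only [hT, hdeh, hQμ]
  have hw : ρc - C lam ∈ I := by
    refine mem_span_X_of_constantCoeff_eq_zero ?_
    rw [map_sub, constantCoeff_C, hlam, sub_self]
  have hpow : ρc ^ (e - μ) - C (lam ^ (e - μ)) ∈ I := by
    obtain ⟨t, ht⟩ := sub_dvd_pow_sub_pow ρc (C lam) (e - μ)
    rw [C_pow, ht]
    exact I.mul_mem_right t hw
  have hrest : ∀ m ∈ (Finset.range (e + 1)).erase μ, T m ∈ I ^ (μ + 1) := by
    intro m hm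
    have hne : m ≠ μ := Finset.ne_of_mem_erase hm
    rcases Nat.lt_or_gt_of_ne hne with hlt | hgt
    · have h0 : homogeneousComponent m (ProjectiveSpace.dehomogenize K c₀ P) = 0 := by rw [hdeh]; exact hQlt m hlt
      simp only [hT, h0, map_zero, mul_zero]
      exact zero_mem _
    · have hmem : aeval M (homogeneousComponent m (ProjectiveSpace.dehomogenize K c₀ P)) ∈ I ^ (μ + 1) :=
        Ideal.pow_le_pow_right hgt (aeval_mem_pow_of_forall_mem M hMmem (mem_pow_of_isHomogeneous (homogeneousComponent_isHomogeneous m _)))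
      exact (I ^ (μ + 1)).mul_mem_left _ hmem
  refine ⟨(ρc ^ (e - μ) - C (lam ^ (e - μ))) * aeval M Φ + ∑ m ∈ (Finset.range (e + 1)).erase μ, T m, ?_, ?_⟩
  · refine (I ^ (μ + 1)).add_mem ?_ (Ideal.sum_mem _ hrest)
    have h := Ideal.mul_mem_mul hpow (aeval_mem_pow_of_forall_mem M hMmem (mem_pow_of_isHomogeneous hΦ))
    rwa [← pow_succ'] at h
  · rw [hexp, hTμ]
    ring

/-! ## Two-index linear parts -/

/-- **Linear parts of mutually inverse substitutions exchanging two vertices are mutually inverse**: `σ*(σ'_i) = x_i`, `σ'` linear forms with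
`σ'_i(e_{c₀}) = 0` for `i ≠ c` (it maps `e_{c₀}` to the line of `e_c`); `M_i = σ_{c₀.succAbove i}(x_c := 1)`, `M'_j = σ'_{c.succAbove j}(x_{c₀} := 1)`:
`M*(M'_j) = y_j`. [cite: Hartshorne1977, II Example 7.1.1] -/
theorem aeval_linearPart_linearPart₂ (c c₀ : Fin (N + 1)) (σ σ' : Fin (N + 1) → MvPolynomial (Fin (N + 1)) K)
    (hσ' : ∀ i, (σ' i).IsHomogeneous 1) (hinv : ∀ i, aeval σ (σ' i) = X i)
    (hfix : ∀ i, i ≠ c → eval (Pi.single c₀ 1 : Fin (N + 1) → K) (σ' i) = 0) (j : Fin N) :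
    aeval (fun i => ProjectiveSpace.dehomogenize K c (σ (c₀.succAbove i))) (ProjectiveSpace.dehomogenize K c₀ (σ' (c.succAbove j))) = X j := by
  have h1 : ProjectiveSpace.dehomogenize K c (aeval σ (σ' (c.succAbove j))) = X j := by
    rw [hinv, ProjectiveSpace.dehomogenize_X_succAbove]
  have hρ : (fun i => ProjectiveSpace.dehomogenize K c (σ i)) =
      Fin.insertNth c₀ (ProjectiveSpace.dehomogenize K c (σ c₀)) (fun i => ProjectiveSpace.dehomogenize K c (σ (c₀.succAbove i))) := by
    funext l
    rcases Fin.eq_self_or_eq_succAbove c₀ l with rfl | ⟨i, rfl⟩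
    · rw [Fin.insertNth_apply_same]
    · rw [Fin.insertNth_apply_succAbove]
  rw [dehomogenize_aeval, hρ] at h1
  rw [aeval_dehomogenize_eq, aeval_insertNth_eq_of_eval_single_eq_zero c₀ (hσ' _) (hfix _ (Fin.succAbove_ne c j)) 1
    (ProjectiveSpace.dehomogenize K c (σ c₀))]
  exact h1

/-! ## ★ The tangent-cone transport with a free chart index -/

/-- ★ **Transport of the ordinary-point datum, free chart**: `τ, τ'` mutually inverse linear substitutions; `b` with `b_{c₀} = 1` and `τ'(e_c) = λ·b`,
`λ = τ'_{c₀}(e_c)`; `F` a form of degree `d` whose chart `F(x_{c₀} := 1)` translated to `b` is `Φ + Ψ` (`Φ` a nonsingular form of degree `μ`,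
`Ψ ∈ (y)^{μ+1}`).  Then `σ_{τ'}F(x_c := 1) = Φ' + Ψ'` with `Φ'` a nonsingular form of degree `μ`, `Ψ' ∈ (y)^{μ+1}`.
[cite: Hartshorne1977, I Ex. 5.8, II Example 7.1.1] [cite: Matsumura1987, §14] -/
theorem ord_linSubst_of_translatedChart₂ [IsAlgClosed K] {m : ℕ} (c c₀ : Fin (m + 2 + 1))
    (τ τ' : Fin (m + 2 + 1) → MvPolynomial (Fin (m + 2 + 1)) K) (hτ : ∀ i, (τ i).IsHomogeneous 1) (hτ' : ∀ i, (τ' i).IsHomogeneous 1)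
    (hinv : ∀ i, aeval τ (τ' i) = X i) (hinv' : ∀ i, aeval τ' (τ i) = X i)
    (b : Fin (m + 2 + 1) → K) (hb1 : b c₀ = 1)
    (hbτ : ∀ i, eval (Pi.single c 1 : Fin (m + 2 + 1) → K) (τ' i) = eval (Pi.single c 1 : Fin (m + 2 + 1) → K) (τ' c₀) * b i)
    (F : MvPolynomial (Fin (m + 2 + 1)) K) {d : ℕ} (hF : F.IsHomogeneous d)
    {μ : ℕ} {Φ Ψ : MvPolynomial (Fin (m + 2)) K} (hΦ : Φ.IsHomogeneous μ) (hns : IsNonsingularForm K Φ)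
    (hΨ : Ψ ∈ Ideal.span (Set.range (X : Fin (m + 2) → MvPolynomial (Fin (m + 2)) K)) ^ (μ + 1))
    (heq : aeval (fun j : Fin (m + 2) => (X j : MvPolynomial (Fin (m + 2)) K) + C (b (c₀.succAbove j))) (ProjectiveSpace.dehomogenize K c₀ F) = Φ + Ψ) :
    ∃ (Φ' Ψ' : MvPolynomial (Fin (m + 2)) K), Φ'.IsHomogeneous μ ∧ IsNonsingularForm K Φ' ∧
      Ψ' ∈ Ideal.span (Set.range (X : Fin (m + 2) → MvPolynomial (Fin (m + 2)) K)) ^ (μ + 1) ∧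
        ProjectiveSpace.dehomogenize K c (aeval τ' F) = Φ' + Ψ' := by
  classical
  set sh : Fin (m + 2 + 1) → MvPolynomial (Fin (m + 2 + 1)) K :=
    fun i => if i = c₀ then (X c₀ : MvPolynomial (Fin (m + 2 + 1)) K) else X i + C (1 * b i) * X c₀ with hsh
  set ush : Fin (m + 2 + 1) → MvPolynomial (Fin (m + 2 + 1)) K :=
    fun i => if i = c₀ then (X c₀ : MvPolynomial (Fin (m + 2 + 1)) K) else X i + C (-1 * b i) * X c₀ with hush
  set P := aeval sh F with hPdef
  set σ : Fin (m + 2 + 1) → MvPolynomial (Fin (m + 2 + 1)) K := fun i => aeval τ' (ush i) with hσ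
  set σ' : Fin (m + 2 + 1) → MvPolynomial (Fin (m + 2 + 1)) K := fun i => aeval sh (τ i) with hσ'
  set e : Fin (m + 2 + 1) → K := Pi.single c 1 with he
  set e₀ : Fin (m + 2 + 1) → K := Pi.single c₀ 1 with he₀
  set lam : K := eval e (τ' c₀) with hlam
  have hush_sh : ∀ i, aeval ush (sh i) = X i := fun i => by
    have h := aeval_shear_shear c₀ b 1 i
    rwa [show (-(1 : K)) = -1 from rfl] at h
  have hsh_ush : ∀ i, aeval sh (ush i) = X i := fun i => by
    have h := aeval_shear_shear c₀ b (-1) i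
    rwa [neg_neg] at h
  have hshlin : ∀ i, (sh i).IsHomogeneous 1 := isHomogeneous_shear c₀ b 1
  have hushlin : ∀ i, (ush i).IsHomogeneous 1 := isHomogeneous_shear c₀ b (-1)
  have hP : P.IsHomogeneous d := by
    have h := hF.aeval sh hshlin
    rwa [one_mul] at h
  have hdehP : ProjectiveSpace.dehomogenize K c₀ P = Φ + Ψ := by
    rw [hPdef, dehomogenize_shear_eq_translate]; exact heq
  have hσsh : ∀ l, aeval σ (sh l) = τ' l := fun l => by
    rw [hσ, ← MvPolynomial.comp_aeval, AlgHom.comp_apply, hush_sh, aeval_X]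
  have hσ'τ' : ∀ l, aeval σ' (τ' l) = sh l := fun l => by
    rw [hσ', ← MvPolynomial.comp_aeval, AlgHom.comp_apply, hinv, aeval_X]
  have hG : aeval σ P = aeval τ' F := by
    rw [hPdef, ← AlgHom.comp_apply, MvPolynomial.comp_aeval, show (fun i => aeval σ (sh i)) = τ' from funext hσsh]
  have hinvσ : ∀ i, aeval σ (σ' i) = X i := fun i => by
    show aeval σ (aeval sh (τ i)) = X i
    rw [← AlgHom.comp_apply, MvPolynomial.comp_aeval, show (fun l => aeval σ (sh l)) = τ' from funext hσsh, hinv']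
  have hinvσ' : ∀ i, aeval σ' (σ i) = X i := fun i => by
    show aeval σ' (aeval τ' (ush i)) = X i
    rw [← AlgHom.comp_apply, MvPolynomial.comp_aeval, show (fun l => aeval σ' (τ' l)) = sh from funext hσ'τ', hsh_ush]
  have hσlin : ∀ i, (σ i).IsHomogeneous 1 := fun i => by
    have h := (hushlin i).aeval τ' hτ'
    rwa [one_mul] at h
  have hσ'lin : ∀ i, (σ' i).IsHomogeneous 1 := fun i => by
    have h := (hτ i).aeval sh hshlin
    rwa [one_mul] at h
  -- `σ` maps `e_c` to the line of `e_{c₀}`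
  have hσe : ∀ i, i ≠ c₀ → eval e (σ i) = 0 := fun i hi => by
    have h1 : σ i = τ' i + C (-1 * b i) * τ' c₀ := by
      simp only [hσ, hush, if_neg hi, map_add, map_mul, aeval_X, aeval_C, MvPolynomial.algebraMap_eq]
    rw [h1, map_add, map_mul, eval_C, hbτ i]
    ring
  have hσfix : ∀ i, i ≠ c₀ → constantCoeff (ProjectiveSpace.dehomogenize K c (σ i)) = 0 := fun i hi => by
    rw [constantCoeff_dehomogenize]; exact hσe i hi
  have hlam0 : lam ≠ 0 := by
    intro h0
    have hall : ∀ j, eval e (τ' j) = 0 := fun j => by rw [hbτ j, h0, zero_mul]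
    have h1 := eval_linSubst_point τ τ' hinv' e c
    rw [show (fun j => eval e (τ' j)) = (0 : Fin (m + 2 + 1) → K) from funext fun j => by rw [hall j]; rfl,
      eval_zero_of_isHomogeneous_one (hτ c), he, Pi.single_eq_same] at h1
    exact zero_ne_one h1
  -- `σ'` maps `e_{c₀}` to the line of `e_c`
  have hshe : (fun l => eval e₀ (sh l)) = b := by
    funext l
    by_cases hl : l = c₀
    · subst hl
      simp only [hsh, if_pos rfl, eval_X, he₀, Pi.single_eq_same, hb1]
    · simp only [hsh, if_neg hl, map_add, map_mul, eval_X, eval_C, he₀, Pi.single_eq_same, Pi.single_eq_of_ne hl]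
      ring
  have hbe : b = lam⁻¹ • fun j => eval e (τ' j) := by
    funext i
    rw [Pi.smul_apply, smul_eq_mul, hbτ i, ← mul_assoc, inv_mul_cancel₀ hlam0, one_mul]
  have hσ'e : ∀ i, i ≠ c → eval e₀ (σ' i) = 0 := fun i hi => by
    show eval e₀ (aeval sh (τ i)) = 0
    rw [eval_aeval_eq_eval, hshe, hbe, eval_smul_of_isHomogeneous_one (hτ i), eval_linSubst_point τ τ' hinv' e i, he,
      Pi.single_eq_of_ne hi, mul_zero]
  -- linear parts
  set M : Fin (m + 2) → MvPolynomial (Fin (m + 2)) K := fun j => ProjectiveSpace.dehomogenize K c (σ (c₀.succAbove j)) with hM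
  set M' : Fin (m + 2) → MvPolynomial (Fin (m + 2)) K := fun j => ProjectiveSpace.dehomogenize K c₀ (σ' (c.succAbove j)) with hM'
  have hM'lin : ∀ j, (M' j).IsHomogeneous 1 := fun j =>
    isHomogeneous_one_dehomogenize c₀ (hσ'lin _) (hσ'e _ (Fin.succAbove_ne c j))
  have hMlin : ∀ j, (M j).IsHomogeneous 1 := fun j =>
    isHomogeneous_one_dehomogenize c (hσlin _) (hσe _ (Fin.succAbove_ne c₀ j))
  have hMM' : ∀ j, aeval M (M' j) = X j := fun j => aeval_linearPart_linearPart₂ c c₀ σ σ' hσ'lin hinvσ hσ'e j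
  have hM'M : ∀ j, aeval M' (M j) = X j := fun j => aeval_linearPart_linearPart₂ c₀ c σ' σ hσlin hinvσ' hσe j
  have hnsM : IsNonsingularForm K (aeval M Φ) := isNonsingularForm_aeval_of_linSubst M' M hM'lin hM'M hMM' hns
  have hμd : μ ≤ d := by
    by_contra hlt
    push Not at hlt
    obtain ⟨hQμ, -⟩ := homogeneousComponent_add_of_mem_pow hΦ hΨ
    have h0 : homogeneousComponent μ (ProjectiveSpace.dehomogenize K c₀ P) = 0 :=
      homogeneousComponent_eq_zero μ _ (lt_of_le_of_lt (totalDegree_dehomogenize_le c₀ hP) hlt)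
    rw [hdehP, hQμ] at h0
    exact ne_zero_of_isNonsingularForm hns h0
  obtain ⟨Ψ', hΨ', hexp⟩ := dehomogenize_aeval_eq_initial_add₂ c c₀ hP hΦ hΨ hμd hdehP σ hσfix
  have hlam' : constantCoeff (ProjectiveSpace.dehomogenize K c (σ c₀)) = lam := by
    rw [constantCoeff_dehomogenize, hlam]
    show eval (Pi.single c 1) (aeval τ' (ush c₀)) = eval e (τ' c₀)
    simp only [hush, if_pos rfl, aeval_X, he]
  refine ⟨C (lam ^ (d - μ)) * aeval M Φ, Ψ', ?_, isNonsingularForm_C_mul hnsM (pow_ne_zero _ hlam0), hΨ', ?_⟩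
  · have h1 := hΦ.aeval M hMlin
    have h2 := (isHomogeneous_C (Fin (m + 2)) (lam ^ (d - μ))).mul h1
    simpa using h2
  · rw [← hG, hexp, hlam']

/-! ## ★★★ Matrix form with free charts -/

/-- ★★★ **EL♮ for hypersurfaces whose singular points are ordinary multiple points in linearly general position — matrix form, free charts.**  `K = K̄` of
characteristic `p`; `ι : H ↪ ℙ^{m+2}_K`, `range ι = V₊(F)`, `F` a prime form; `B ∈ GL_{m+3}(K)`, `S` duplicate-free; for each `c ∈ S` a chart index `c₀ c` with
`B_{c₀(c), c} = 1`; (ordF) the chart `F(x_{c₀ c} := 1)` translated to `P_c = [B_{·c}]` reads `Φ_c + Ψ_c`, `Φ_c` a NONSINGULAR form of degree `μ_c ≥ 1`,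
`Ψ_c ∈ (y)^{μ_c+1}`; (jacF) every `b ≠ 0` with `F(b) = 0`, `∇F(b) = 0` is `s·B_{·c}` for some `c ∈ S`.  Then `Theorems.EquisingularLift.ELNatAt p K (m+2) H ι`.
[OURS · L1 W4.5b] [cite: Hartshorne1977, I Thm. 5.1, II Example 7.1.1] [cite: StacksProject, Tag 080A] -/
theorem elNatAt_of_ordinaryPoints_matrix₂ (p : ℕ) (hp : p.Prime) [CharP K p] [IsAlgClosed K] {m : ℕ}
    {H : Scheme.{0}} (ι : H ⟶ (projectiveSpace (m + 1 + 1) K).left) [IsClosedImmersion ι]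
    (F : MvPolynomial (Fin (m + 1 + 1 + 1)) K) {d : ℕ} (hF : F.IsHomogeneous d) (hFp : Prime F)
    (hrange : letI := MvPolynomial.gradedAlgebra (σ := Fin (m + 1 + 1 + 1)) (R := K)
      Set.range ι = {x : Proj (homogeneousSubmodule (Fin (m + 1 + 1 + 1)) K) | F ∈ x.asHomogeneousIdeal})
    (B : Matrix (Fin (m + 1 + 1 + 1)) (Fin (m + 1 + 1 + 1)) K) (hB : IsUnit B.det)
    (S : List (Fin (m + 2 + 1))) (hS : S.Nodup) (c₀ : Fin (m + 2 + 1) → Fin (m + 2 + 1)) (hB1 : ∀ c ∈ S, B (c₀ c) c = 1)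
    (hordF : ∀ c ∈ S, ∃ (μ : ℕ) (Φ Ψ : MvPolynomial (Fin (m + 2)) K), 1 ≤ μ ∧ Φ.IsHomogeneous μ ∧ IsNonsingularForm K Φ ∧
      Ψ ∈ Ideal.span (Set.range (X : Fin (m + 2) → MvPolynomial (Fin (m + 2)) K)) ^ (μ + 1) ∧
        aeval (fun j : Fin (m + 2) => (X j : MvPolynomial (Fin (m + 2)) K) + C (B ((c₀ c).succAbove j) c))
          (ProjectiveSpace.dehomogenize K (c₀ c) F) = Φ + Ψ)
    (hjacF : ∀ b : Fin (m + 2 + 1) → K, b ≠ 0 → eval b F = 0 → (∀ j, eval b (pderiv j F) = 0) →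
      ∃ c ∈ S, ∃ s : K, b = s • fun l => B l c) :
    Theorems.EquisingularLift.ELNatAt p K (m + 1 + 1) H ι := by
  refine elNatAt_of_linSubst_ordinaryPoints_of_jacobian' p hp ι F hF hFp hrange (B⁻¹).toMvPolynomial B.toMvPolynomial
    (Matrix.toMvPolynomial_isHomogeneous _) (Matrix.toMvPolynomial_isHomogeneous _)
    (aeval_toMvPolynomial_inv_toMvPolynomial B hB) (aeval_toMvPolynomial_toMvPolynomial_inv B hB) S hS (fun c hc => ?_) (fun b hb h0 hd => ?_)
  · obtain ⟨μ, Φ, Ψ, hμ, hΦ, hns, hΨ, heq⟩ := hordF c hc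
    obtain ⟨Φ', Ψ', hΦ', hns', hΨ', heq'⟩ := ord_linSubst_of_translatedChart₂ c (c₀ c) (B⁻¹).toMvPolynomial B.toMvPolynomial
      (Matrix.toMvPolynomial_isHomogeneous _) (Matrix.toMvPolynomial_isHomogeneous _)
      (aeval_toMvPolynomial_inv_toMvPolynomial B hB) (aeval_toMvPolynomial_toMvPolynomial_inv B hB)
      (fun l => B l c) (hB1 c hc) (fun i => by rw [eval_single_toMvPolynomial, eval_single_toMvPolynomial, hB1 c hc, one_mul]) F hF hΦ hns hΨ heq
    exact ⟨μ, Φ', Ψ', hμ, hΦ', hns', hΨ', heq'⟩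
  · obtain ⟨c, hc, s, rfl⟩ := hjacF b hb h0 hd
    exact ⟨c, hc, fun i hi => eval_toMvPolynomial_inv_eq_zero B hB c s i hi⟩

end MultiOrd

end Summit.ResolutionOfSingularities.ResolutionOfSingularities.Cruxes.EquisingularLiftNat.Sections

namespace Summit.ResolutionOfSingularities.ResolutionOfSingularities.Cruxes.EquisingularLift.StrataSplit

open Summit.ResolutionOfSingularities.ResolutionOfSingularities.Cruxes.EquisingularLiftNat.Sections

/-- ★★★ **Regular blow-up models for hypersurfaces whose singular points are ordinary multiple points in linearly general position — matrix form, free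
charts** (`K = K̄`, any characteristic / dimension / degree): hypotheses of ✓ `MultiOrd.elNatAt_of_ordinaryPoints_matrix₂`; conclusion = that of the OPEN
residual `stub_blowupModel_ge_five` at `H`. [cite: Hartshorne1977, I Thm. 5.1, II Example 7.1.1, II Ex. 7.12] -/
theorem blowupModel_of_ordinaryPoints_matrix₂ {K : Type} [Field K] [IsAlgClosed K] {m : ℕ} {H : Scheme.{0}}
    (ι : H ⟶ (projectiveSpace (m + 1 + 1) K).left) [IsClosedImmersion ι] [IsIntegral H]
    (F : MvPolynomial (Fin (m + 1 + 1 + 1)) K) {d : ℕ} (hF : F.IsHomogeneous d) (hFp : Prime F)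
    (hrange : letI := MvPolynomial.gradedAlgebra (σ := Fin (m + 1 + 1 + 1)) (R := K)
      Set.range ι = {x : Proj (homogeneousSubmodule (Fin (m + 1 + 1 + 1)) K) | F ∈ x.asHomogeneousIdeal})
    (B : Matrix (Fin (m + 1 + 1 + 1)) (Fin (m + 1 + 1 + 1)) K) (hB : IsUnit B.det)
    (S : List (Fin (m + 2 + 1))) (hS : S.Nodup) (c₀ : Fin (m + 2 + 1) → Fin (m + 2 + 1)) (hB1 : ∀ c ∈ S, B (c₀ c) c = 1)
    (hordF : ∀ c ∈ S, ∃ (μ : ℕ) (Φ Ψ : MvPolynomial (Fin (m + 2)) K), 1 ≤ μ ∧ Φ.IsHomogeneous μ ∧ IsNonsingularForm K Φ ∧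
      Ψ ∈ Ideal.span (Set.range (X : Fin (m + 2) → MvPolynomial (Fin (m + 2)) K)) ^ (μ + 1) ∧
        aeval (fun j : Fin (m + 2) => (X j : MvPolynomial (Fin (m + 2)) K) + C (B ((c₀ c).succAbove j) c))
          (ProjectiveSpace.dehomogenize K (c₀ c) F) = Φ + Ψ)
    (hjacF : ∀ b : Fin (m + 2 + 1) → K, b ≠ 0 → eval b F = 0 → (∀ j, eval b (pderiv j F) = 0) →
      ∃ c ∈ S, ∃ s : K, b = s • fun l => B l c) :
    ∃ 𝔞 : H.IdealSheafData, 𝔞 ≠ ⊥ ∧ ∀ (Z : Scheme.{0}) (π : Z ⟶ H), IsBlowup π 𝔞 → Scheme.IsRegular Z := by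
  refine blowupModel_of_range_eq_of_linSubst_ordinaryPoints_of_jacobian' ι F hF hFp hrange (B⁻¹).toMvPolynomial B.toMvPolynomial
    (Matrix.toMvPolynomial_isHomogeneous _) (Matrix.toMvPolynomial_isHomogeneous _)
    (MultiOrd.aeval_toMvPolynomial_inv_toMvPolynomial B hB) (MultiOrd.aeval_toMvPolynomial_toMvPolynomial_inv B hB) S hS
    (fun c hc => ?_) (fun b hb h0 hd => ?_)
  · obtain ⟨μ, Φ, Ψ, hμ, hΦ, hns, hΨ, heq⟩ := hordF c hc
    obtain ⟨Φ', Ψ', hΦ', hns', hΨ', heq'⟩ := MultiOrd.ord_linSubst_of_translatedChart₂ c (c₀ c) (B⁻¹).toMvPolynomial B.toMvPolynomial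
      (Matrix.toMvPolynomial_isHomogeneous _) (Matrix.toMvPolynomial_isHomogeneous _)
      (MultiOrd.aeval_toMvPolynomial_inv_toMvPolynomial B hB) (MultiOrd.aeval_toMvPolynomial_toMvPolynomial_inv B hB)
      (fun l => B l c) (hB1 c hc)
      (fun i => by rw [MultiOrd.eval_single_toMvPolynomial, MultiOrd.eval_single_toMvPolynomial, hB1 c hc, one_mul]) F hF hΦ hns hΨ heq
    exact ⟨μ, Φ', Ψ', hμ, hΦ', hns', hΨ', heq'⟩
  · obtain ⟨c, hc, s, rfl⟩ := hjacF b hb h0 hd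
    exact ⟨c, hc, fun i hi => MultiOrd.eval_toMvPolynomial_inv_eq_zero B hB c s i hi⟩

end Summit.ResolutionOfSingularities.ResolutionOfSingularities.Cruxes.EquisingularLift.StrataSplit

end
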